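import Summits.BirchSwinnertonDyer.BirchSwinnertonDyer.Theorems.ByReductionTypeAtTwoTowerLambdaRank
import HarnessLib

/-!
# The TOWER door at LEVEL ONE: `2^n ≤ #X/(2,T)X` (layer `ℚ`) + `#X/(2,T²)X ≤ 2^n`
# (layer `ℚ(√2)`) ⇒ `TowerGapAtTwo W` with `(m,k) = (1,1)` ⇒ `μ = 0`, `λ(X) = n`, the `2`-adic IMC,
# the Kato half and `BSD(E,2)` (route ByReductionTypeAtTwo, crux `OrdKatoHalfAtTwo`,
# item stmt-BirchSwinnertonDyer-19271; seat bsd-2adic-ord-2, GEN 2)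

HONEST FRAMING (cell `bsd-2adic`, run/shared/lean/pub/bsd-2adic/, HUMAN RULINGS D-0036/D-0074): THEOREMS
ONLY; nothing asserted; no definition; no new named fact; closes nothing by itself. BSD is not
advanced by this file beyond the typed reduction it states.

## What this file adds to the TOWER road (p419348 / p419840 / p424818)

The doors of `…TowerLambdaPinch` / `…TowerLambdaRank` / `…TowerLayerRank` take the certificate
`TowerGapAtTwo W` = «for every cyclotomic datum, ONE gap `#X/(2,T^{m+k})X < 2^k · #X/(2,T^m)X`» as a
hypothesis. The seat's MEMO-1 (GEN 0) priced that gap with the CYCLIC model `a_j = min(j, λ)`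
(`a_j := dim_{𝔽₂} X/(2,T^j)X`) and concluded that the layers `ℚ, ℚ(√2)` never suffice on the open
irreducible block (`λ_an ≥ 2` there). That pricing is too pessimistic: on every open class
`dim_{𝔽₂} Ш(E/ℚ)[2] ≥ 2`, and `Sel_{2^∞}(E/ℚ)[2] ↪` (counted by) `X/(2,T)X`
(`finite_and_natCard_selmerLayer_pTorsion_le`, layer `0`), so `a_1 ≥ 2` and `X/2X` is NEVER cyclic
there. The cheapest gap is then `(m,k) = (1,1)`: `a_2 < 1 + a_1`, i.e. `a_2 ≤ a_1`, i.e. the layer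
quotients STABILISE at the first step — equivalently `T·(X/2X) = 0` (§1:
`xPowSubmodule_one_eq_bot_of_card_le`, Nakayama), and then `#X/(2,T^j)X = #X/2X` for EVERY `j ≥ 1`
(`natCard_quotient_towerIdeal_eq_of_levelOne`): no new `2`-torsion Selmer class (with the
`ℚ_∞`-induced conditions) appears at any layer of the tower.

* §1 (pure `Λ`-algebra, any `p`): stabilisation `#M/(p,T^{m+1})M ≤ #M/(p,T^m)M` IS a gap
  (`card_quotient_towerIdeal_succ_lt_of_le`, `k = 1`); a two-layer count `b < k + a` with
  `#M/(p,T^{m+k})M ≤ p^b`, `p^a ≤ #M/(p,T^m)M` IS a gap (`card_quotient_towerIdeal_lt_of_pow_bounds`);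
  and under stabilisation at `m = 1` all layer quotients from `j = 1` on have the same order
  (`natCard_quotient_towerIdeal_eq_of_levelOne`).
* §2 (`p = 2`, module form, for every cyclotomic datum): the LEVEL-ONE certificate
  {`2^n ≤ #X/(2,T)X` (layer `ℚ`), `#X/(2,T²)X ≤ 2^n` (layer `ℚ(√2)`)} ⇒ `TowerGapAtTwo W`
  (`towerGapAtTwo_of_levelOne`) and `#X/(2,T^j)X = 2^n` for all `j ≥ 1`
  (`natCard_quotient_towerIdeal_eq_pow_of_levelOne`); the general LAYER-PAIR certificate
  {`2^a ≤ #X/(2,T^{2^j})X`, `#X/(2,T^{2^{j+1}})X ≤ 2^b`, `b < 2^j + a`} ⇒ `TowerGapAtTwo W`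
  (`towerGapAtTwo_of_layerPair`); the lower bound is the `hrank` input verbatim
  (`towerRank_of_levelOne`).
* §3 the doors with the gap DISCHARGED by the level-one certificate (odd torsion order): PRINT
  {Kato 17.4 (1)(2)@2, Greenberg Prop. 4.14@2; at rank 0 also Greenberg Thm. 4.1@2 (`hEC`, δ = 0),
  modularity, GZK} + certificates {`hper₀`, `2^n ≤ #X/(2,T)X`, `#X/(2,T²)X ≤ 2^n`, `μ_an = 0`,
  `λ_an = n`} ⇒ `X` torsion ∧ `μ = 0` ∧ `n ≤ λ(X)` (`isTorsion_mu_zero_le_lambda_of_levelOne`),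
  `MazurMainConjecture W 2`, the Kato–Néron half `MainConjectureLowerDivisibilityAtTwoOrd W` (= the
  item `OrdKatoHalfAtTwo` AT `W`), `BSDp W 2`.

READING (for the planner / the (E1) engineer; nothing asserted): the layer-`ℚ` input is DISCHARGED by
the companion file `…TowerLayerRank` (seat bsd-2adic-tower-1, p424818:
`#Sel_{2^∞}(E/ℚ)[2] ≤ #X/(2,T)X` when `E(ℚ)[2] = 0`), i.e. by a `2`-descent over `ℚ`:
`#Sel_{2^∞}(E/ℚ)[2] = 2^{d₀}`, `d₀ = dim_{𝔽₂} Sel₂(E/ℚ) = dim_{𝔽₂} Ш(E/ℚ)[2]` at rank `0`. The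
level-one door applies exactly when `λ_an = d₀` (then `a_1 = a_2 = λ(X) = λ_an`), e.g. `λ_an = 2` with
`Ш(E/ℚ)[2^∞] ⊇ (ℤ/4)²` or `λ_an = 4` with `Ш(E/ℚ)[2] ≅ (ℤ/2)⁴`; the only number-field input is ONE upper
bound at the layer `ℚ(√2)`. WHAT IS STILL MISSING (typed elsewhere, seat bsd-2adic-tower-1): the
upper-half bridge `#X/(2,ω_1)X ≤ #A_1[2]`, `A_1 = h_1⁻¹(Sel_∞) ⊆ H¹(ℚ(√2), E[2^∞])`, which turns
`hup₂` into a generalised `2`-descent count over `ℚ(√2)`.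

References: R. Greenberg, LNM 1716 (1999), §1 p. 60, §3 pp. 85–91, Thm. 4.1, Prop. 4.14; L. Washington,
*Introduction to Cyclotomic Fields*, §13.2 (Nakayama over `Λ`); K. Kato, Astérisque 295 (2004), Thm. 17.4.
-/

set_option autoImplicit false

noncomputable section

open scoped Classical MatrixGroups ModularForm

open CongruenceSubgroup WeierstrassCurve Literature.NumberTheory.EllipticCurves
  Literature.NumberTheory.EllipticCurves.ModularForms Literature.NumberTheory.EllipticCurves.Rank1Residual
  Literature.NumberTheory.EllipticCurves.Rank1Residual.Typed
  Literature.NumberTheory.EllipticCurves.Greenberg1999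
  Summit.BirchSwinnertonDyer.Rank1Residual.X1.MuLambda
  Summit.BirchSwinnertonDyer.Rank1Residual.X1.MuPart
  Summit.BirchSwinnertonDyer.Rank1Residual.X1.ParitySqueeze
  Summit.BirchSwinnertonDyer.BirchSwinnertonDyer.Theorems.Rank1ResidualX1Defs
  Summit.BirchSwinnertonDyer.Rank1Residual.X5 Summit.BirchSwinnertonDyer.Rank1Residual.X5.O1
  Summit.BirchSwinnertonDyer.Rank1Residual.X5.TowerGap
  Summit.BirchSwinnertonDyer.Rank1Residual

namespace Summit.BirchSwinnertonDyer.BirchSwinnertonDyer.Theorems.KatoHalfPinch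

/-! ## §1 Pure `Λ`-algebra (any `p`): stabilisation is a gap; under stabilisation the layers freeze -/

section Algebra

variable (p : ℕ) [hp : Fact p.Prime] {M : Type*} [AddCommGroup M] [Module (IwasawaAlgebra p) M]

/-- **Stabilisation is a gap.** For `M` finitely generated over `Λ = ℤ_p⟦T⟧` (so `M/(p,T^m)M` is a
non-empty finite set), `#M/(p,T^{m+1})M ≤ #M/(p,T^m)M` gives the tower gap
`#M/(p,T^{m+1})M < p^1 · #M/(p,T^m)M`. [folklore] -/
theorem card_quotient_towerIdeal_succ_lt_of_le [Module.Finite (IwasawaAlgebra p) M] {m : ℕ}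
    (h : Nat.card (M ⧸ (towerIdeal p (m + 1) • ⊤ : Submodule (IwasawaAlgebra p) M)) ≤
      Nat.card (M ⧸ (towerIdeal p m • ⊤ : Submodule (IwasawaAlgebra p) M))) :
    Nat.card (M ⧸ (towerIdeal p (m + 1) • ⊤ : Submodule (IwasawaAlgebra p) M)) <
      p ^ 1 * Nat.card (M ⧸ (towerIdeal p m • ⊤ : Submodule (IwasawaAlgebra p) M)) := by
  haveI := finite_quotient_towerIdeal p (M := M) m
  have hpos : 0 < Nat.card (M ⧸ (towerIdeal p m • ⊤ : Submodule (IwasawaAlgebra p) M)) :=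
    Nat.card_pos
  have hp1 : 1 < p := hp.out.one_lt
  rw [pow_one]
  exact lt_of_le_of_lt h ((Nat.lt_mul_iff_one_lt_left hpos).mpr hp1)

/-- **A two-layer count is a gap.** `#M/(p,T^{m+k})M ≤ p^b`, `p^a ≤ #M/(p,T^m)M` and `b < k + a`
give `#M/(p,T^{m+k})M < p^k · #M/(p,T^m)M`. [folklore] -/
theorem card_quotient_towerIdeal_lt_of_pow_bounds {m k a b : ℕ}
    (hup : Nat.card (M ⧸ (towerIdeal p (m + k) • ⊤ : Submodule (IwasawaAlgebra p) M)) ≤ p ^ b)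
    (hlow : p ^ a ≤ Nat.card (M ⧸ (towerIdeal p m • ⊤ : Submodule (IwasawaAlgebra p) M)))
    (hab : b < k + a) :
    Nat.card (M ⧸ (towerIdeal p (m + k) • ⊤ : Submodule (IwasawaAlgebra p) M)) <
      p ^ k * Nat.card (M ⧸ (towerIdeal p m • ⊤ : Submodule (IwasawaAlgebra p) M)) := by
  have hp1 : 1 < p := hp.out.one_lt
  calc Nat.card (M ⧸ (towerIdeal p (m + k) • ⊤ : Submodule (IwasawaAlgebra p) M))
      ≤ p ^ b := hup
    _ < p ^ (k + a) := Nat.pow_lt_pow_right hp1 hab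
    _ = p ^ k * p ^ a := pow_add p k a
    _ ≤ p ^ k * Nat.card (M ⧸ (towerIdeal p m • ⊤ : Submodule (IwasawaAlgebra p) M)) :=
        Nat.mul_le_mul_left _ hlow

/-- **Under stabilisation at the first step, `T` kills `M/pM`.** With `N := M/pM`:
`#N/T²N ≤ #N/TN` (both finite) forces `TN = T²N`, hence `TN = 0` by Nakayama (`T ∈ 𝔪_Λ`).
[cite: Washington1997, §13.2 (Nakayama's lemma for `Λ`)] -/
theorem xPowSubmodule_one_eq_bot_of_card_le [Module.Finite (IwasawaAlgebra p) M]
    (h : Nat.card (M ⧸ (towerIdeal p 2 • ⊤ : Submodule (IwasawaAlgebra p) M)) ≤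
      Nat.card (M ⧸ (towerIdeal p 1 • ⊤ : Submodule (IwasawaAlgebra p) M))) :
    xPowSubmodule p (M ⧸ modPSubmodule p M) 1 = ⊥ := by
  set N := M ⧸ modPSubmodule p M
  -- transport the two counts to `N/T²N` and `N/TN`
  rw [Nat.card_congr (quotientTowerIdealEquiv p (M := M) 2).toEquiv,
    Nat.card_congr (quotientTowerIdealEquiv p (M := M) 1).toEquiv] at h
  haveI : Finite (N ⧸ xPowSubmodule p N 2) := by
    haveI := finite_quotient_towerIdeal p (M := M) 2
    exact Finite.of_equiv _ (quotientTowerIdealEquiv p (M := M) 2).toEquiv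
  haveI : Finite (N ⧸ xPowSubmodule p N 1) := by
    haveI := finite_quotient_towerIdeal p (M := M) 1
    exact Finite.of_equiv _ (quotientTowerIdealEquiv p (M := M) 1).toEquiv
  -- `T²N ≤ TN`, and the index count forces equality
  have hle : xPowSubmodule p N 2 ≤ xPowSubmodule p N 1 := xPowSubmodule_antitone p N (by norm_num)
  have hle' : (xPowSubmodule p N 2).toAddSubgroup ≤ (xPowSubmodule p N 1).toAddSubgroup :=
    fun x hx => hle hx
  have hmul := AddSubgroup.relIndex_mul_index hle'
  rw [natCard_quotient_eq_index, natCard_quotient_eq_index] at h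
  have hidx1 : (xPowSubmodule p N 1).toAddSubgroup.index ≠ 0 := by
    rw [← natCard_quotient_eq_index]; exact Nat.card_pos.ne'
  have hidx2 : (xPowSubmodule p N 2).toAddSubgroup.index ≠ 0 := by
    rw [← natCard_quotient_eq_index]; exact Nat.card_pos.ne'
  have hrel : (xPowSubmodule p N 2).toAddSubgroup.relIndex (xPowSubmodule p N 1).toAddSubgroup = 1 := by
    have h1 : (xPowSubmodule p N 2).toAddSubgroup.relIndex (xPowSubmodule p N 1).toAddSubgroup *
        (xPowSubmodule p N 1).toAddSubgroup.index ≤ 1 * (xPowSubmodule p N 1).toAddSubgroup.index := by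
      rw [hmul, one_mul]; exact h
    have h2 := Nat.le_of_mul_le_mul_right h1 (Nat.pos_of_ne_zero hidx1)
    have h3 : (xPowSubmodule p N 2).toAddSubgroup.relIndex (xPowSubmodule p N 1).toAddSubgroup ≠ 0 := by
      intro h0
      rw [h0, zero_mul] at hmul
      exact hidx2 hmul.symm
    omega
  have heq : xPowSubmodule p N 2 = xPowSubmodule p N 1 := by
    refine le_antisymm hle ?_
    intro x hx
    exact (AddSubgroup.relIndex_eq_one.mp hrel) hx
  exact xPowSubmodule_eq_bot_of_eq_succ p (j := 1) heq

/-- **The layers freeze under stabilisation at the first step**: for `M` finitely generated over `Λ`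
with `#M/(p,T²)M ≤ #M/(p,T)M`, every layer quotient from `j = 1` on has the order of `M/pM`:
`#M/(p,T^j)M = #M/(p,T)M` for all `j ≥ 1` (all equal to `#(M/pM)`, `T` acting as `0` on `M/pM`).
[cite: Washington1997, §13.2 (Nakayama's lemma for `Λ`)] -/
theorem natCard_quotient_towerIdeal_eq_of_levelOne [Module.Finite (IwasawaAlgebra p) M]
    (h : Nat.card (M ⧸ (towerIdeal p 2 • ⊤ : Submodule (IwasawaAlgebra p) M)) ≤
      Nat.card (M ⧸ (towerIdeal p 1 • ⊤ : Submodule (IwasawaAlgebra p) M))) {j : ℕ} (hj : 1 ≤ j) :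
    Nat.card (M ⧸ (towerIdeal p j • ⊤ : Submodule (IwasawaAlgebra p) M)) =
      Nat.card (M ⧸ (towerIdeal p 1 • ⊤ : Submodule (IwasawaAlgebra p) M)) := by
  set N := M ⧸ modPSubmodule p M
  have hbot1 : xPowSubmodule p N 1 = ⊥ := xPowSubmodule_one_eq_bot_of_card_le p h
  have hbotj : xPowSubmodule p N j = ⊥ :=
    le_bot_iff.mp ((xPowSubmodule_antitone p N hj).trans hbot1.le)
  rw [Nat.card_congr (quotientTowerIdealEquiv p (M := M) j).toEquiv,
    Nat.card_congr (quotientTowerIdealEquiv p (M := M) 1).toEquiv,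
    Nat.card_congr (Submodule.quotEquivOfEqBot _ hbotj).toEquiv,
    Nat.card_congr (Submodule.quotEquivOfEqBot _ hbot1).toEquiv]

end Algebra

/-! ## §2 `p = 2`: the LEVEL-ONE and LAYER-PAIR certificates (module form) give `TowerGapAtTwo W` -/

section Curve

variable (W : WeierstrassCurve ℚ) [W.IsElliptic] [W.IsGloballyMinimal]

omit [W.IsGloballyMinimal] in
/-- **The LEVEL-ONE certificate gives the tower gap (module form).** For every cyclotomic datum:
`2^n ≤ #X/(2,T)X` (layer `ℚ`: e.g. from `2^n ≤ #Sel_{2^∞}(E/ℚ)[2]`, file `…TowerLayerRank`) and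
`#X/(2,T²)X ≤ 2^n` (layer `ℚ(√2)`, `(2,ω_1) = (2,T²)`). Then the quotients stabilise,
`#X/(2,T²)X ≤ #X/(2,T)X`, which is the gap `(m,k) = (1,1)`: `TowerGapAtTwo W`.
[cite: GreenbergLNM1716, §1 p. 60 and §3 pp. 85–86] [cite: Washington1997, §13.2] -/
theorem towerGapAtTwo_of_levelOne {n : ℕ}
    (hlow₁ : ∀ (κ : ZpExtension ℚ 2) (γ : Field.absoluteGaloisGroup ℚ), κ.IsCyclotomic →
      κ.IsTopGenerator γ → IsCyclotomicVariable 2 γ → ∀ D : W.SelmerDualData κ γ,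
      2 ^ n ≤ Nat.card (D.X ⧸ (towerIdeal 2 1 • ⊤ : Submodule (IwasawaAlgebra 2) D.X)))
    (hup₂ : ∀ (κ : ZpExtension ℚ 2) (γ : Field.absoluteGaloisGroup ℚ), κ.IsCyclotomic →
      κ.IsTopGenerator γ → IsCyclotomicVariable 2 γ → ∀ D : W.SelmerDualData κ γ,
      Nat.card (D.X ⧸ (towerIdeal 2 2 • ⊤ : Submodule (IwasawaAlgebra 2) D.X)) ≤ 2 ^ n) :
    TowerGapAtTwo W := by
  intro κ γ hκ hγ hγ' D
  haveI : Module.Finite (IwasawaAlgebra 2) D.X := D.module_finite_holds hγ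
  refine ⟨1, 1, card_quotient_towerIdeal_succ_lt_of_le 2 ?_⟩
  exact (hup₂ κ γ hκ hγ hγ' D).trans (hlow₁ κ γ hκ hγ hγ' D)

omit [W.IsGloballyMinimal] in
/-- **Under the LEVEL-ONE certificate the layers freeze**: for every cyclotomic datum and every
`j ≥ 1`, `#X/(2,T^j)X = #X/(2,T)X = 2^n` — no new `2`-torsion class (with the `ℚ_∞`-induced local
conditions) appears at any layer of the tower (a reading; the doors below do not use it).
[cite: Washington1997, §13.2] -/
theorem natCard_quotient_towerIdeal_eq_pow_of_levelOne {n : ℕ}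
    (hlow₁ : ∀ (κ : ZpExtension ℚ 2) (γ : Field.absoluteGaloisGroup ℚ), κ.IsCyclotomic →
      κ.IsTopGenerator γ → IsCyclotomicVariable 2 γ → ∀ D : W.SelmerDualData κ γ,
      2 ^ n ≤ Nat.card (D.X ⧸ (towerIdeal 2 1 • ⊤ : Submodule (IwasawaAlgebra 2) D.X)))
    (hup₂ : ∀ (κ : ZpExtension ℚ 2) (γ : Field.absoluteGaloisGroup ℚ), κ.IsCyclotomic →
      κ.IsTopGenerator γ → IsCyclotomicVariable 2 γ → ∀ D : W.SelmerDualData κ γ,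
      Nat.card (D.X ⧸ (towerIdeal 2 2 • ⊤ : Submodule (IwasawaAlgebra 2) D.X)) ≤ 2 ^ n)
    (κ : ZpExtension ℚ 2) (γ : Field.absoluteGaloisGroup ℚ) (hκ : κ.IsCyclotomic)
    (hγ : κ.IsTopGenerator γ) (hγ' : IsCyclotomicVariable 2 γ) (D : W.SelmerDualData κ γ)
    {j : ℕ} (hj : 1 ≤ j) :
    Nat.card (D.X ⧸ (towerIdeal 2 j • ⊤ : Submodule (IwasawaAlgebra 2) D.X)) = 2 ^ n := by
  haveI : Module.Finite (IwasawaAlgebra 2) D.X := D.module_finite_holds hγ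
  have h1 := hlow₁ κ γ hκ hγ hγ' D
  have h2 := hup₂ κ γ hκ hγ hγ' D
  have h21 : Nat.card (D.X ⧸ (towerIdeal 2 2 • ⊤ : Submodule (IwasawaAlgebra 2) D.X)) ≤
      Nat.card (D.X ⧸ (towerIdeal 2 1 • ⊤ : Submodule (IwasawaAlgebra 2) D.X)) := h2.trans h1
  have h12 : Nat.card (D.X ⧸ (towerIdeal 2 1 • ⊤ : Submodule (IwasawaAlgebra 2) D.X)) ≤
      Nat.card (D.X ⧸ (towerIdeal 2 2 • ⊤ : Submodule (IwasawaAlgebra 2) D.X)) := by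
    rw [natCard_quotient_towerIdeal_eq_of_levelOne 2 h21 (by norm_num : 1 ≤ 2)]
  rw [natCard_quotient_towerIdeal_eq_of_levelOne 2 h21 hj]
  exact le_antisymm (h12.trans h2) h1

omit [W.IsElliptic] [W.IsGloballyMinimal] in
/-- **The LAYER-PAIR certificate gives the tower gap (module form).** For two consecutive layers
`ℚ_j ⊂ ℚ_{j+1}` (`(2,ω_j) = (2,T^{2^j})`): `2^a ≤ #X/(2,T^{2^j})X`, `#X/(2,T^{2^{j+1}})X ≤ 2^b` for every
cyclotomic datum, and the count `b < 2^j + a`. Then `TowerGapAtTwo W` with `(m,k) = (2^j, 2^j)`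
(`j = 0`, `a = b = n` is the level-one certificate). [cite: GreenbergLNM1716, §3 pp. 85–91] -/
theorem towerGapAtTwo_of_layerPair {j a b : ℕ}
    (hlow : ∀ (κ : ZpExtension ℚ 2) (γ : Field.absoluteGaloisGroup ℚ), κ.IsCyclotomic →
      κ.IsTopGenerator γ → IsCyclotomicVariable 2 γ → ∀ D : W.SelmerDualData κ γ,
      2 ^ a ≤ Nat.card (D.X ⧸ (towerIdeal 2 (2 ^ j) • ⊤ : Submodule (IwasawaAlgebra 2) D.X)))
    (hup : ∀ (κ : ZpExtension ℚ 2) (γ : Field.absoluteGaloisGroup ℚ), κ.IsCyclotomic →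
      κ.IsTopGenerator γ → IsCyclotomicVariable 2 γ → ∀ D : W.SelmerDualData κ γ,
      Nat.card (D.X ⧸ (towerIdeal 2 (2 ^ (j + 1)) • ⊤ : Submodule (IwasawaAlgebra 2) D.X)) ≤ 2 ^ b)
    (hab : b < 2 ^ j + a) : TowerGapAtTwo W := by
  intro κ γ hκ hγ hγ' D
  refine ⟨2 ^ j, 2 ^ j, ?_⟩
  have hpow : 2 ^ (j + 1) = 2 ^ j + 2 ^ j := by ring
  have hup' := hup κ γ hκ hγ hγ' D
  rw [hpow] at hup'
  exact card_quotient_towerIdeal_lt_of_pow_bounds 2 (m := 2 ^ j) (k := 2 ^ j) hup'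
    (hlow κ γ hκ hγ hγ' D) hab

omit [W.IsElliptic] [W.IsGloballyMinimal] in
/-- The level-one lower bound `2^n ≤ #X/(2,T)X` IS the `hrank` input of the TOWER doors
(`…_of_towerGap_of_towerRank`, witness `j = 1`). [folklore] -/
theorem towerRank_of_levelOne {n : ℕ}
    (hlow₁ : ∀ (κ : ZpExtension ℚ 2) (γ : Field.absoluteGaloisGroup ℚ), κ.IsCyclotomic →
      κ.IsTopGenerator γ → IsCyclotomicVariable 2 γ → ∀ D : W.SelmerDualData κ γ,
      2 ^ n ≤ Nat.card (D.X ⧸ (towerIdeal 2 1 • ⊤ : Submodule (IwasawaAlgebra 2) D.X))) :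
    ∀ (κ : ZpExtension ℚ 2) (γ : Field.absoluteGaloisGroup ℚ), κ.IsCyclotomic →
      κ.IsTopGenerator γ → IsCyclotomicVariable 2 γ → ∀ D : W.SelmerDualData κ γ,
      ∃ j : ℕ, 2 ^ n ≤ Nat.card (D.X ⧸ (towerIdeal 2 j • ⊤ : Submodule (IwasawaAlgebra 2) D.X)) :=
  fun κ γ hκ hγ hγ' D => ⟨1, hlow₁ κ γ hκ hγ hγ' D⟩

/-! ## §3 The doors with the gap DISCHARGED by the LEVEL-ONE certificate -/

/-- **`X` torsion, `μ(X) = 0` and `λ(X) ≥ n` from the level-one certificate** (the `λ`-bound with the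
PUBLISHED Greenberg Prop. 4.14@2, no finite submodule, on a curve with odd torsion order).
[cite: GreenbergLNM1716, Prop. 4.14 (§4)] [cite: Washington1997, §13.2] -/
theorem isTorsion_mu_zero_le_lambda_of_levelOne
    (h414 : prop414_noFiniteSubmodule_of_not_dvd_torsionOrder) (htors : ¬ 2 ∣ W.torsionOrder) {n : ℕ}
    (hlow₁ : ∀ (κ : ZpExtension ℚ 2) (γ : Field.absoluteGaloisGroup ℚ), κ.IsCyclotomic →
      κ.IsTopGenerator γ → IsCyclotomicVariable 2 γ → ∀ D : W.SelmerDualData κ γ,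
      2 ^ n ≤ Nat.card (D.X ⧸ (towerIdeal 2 1 • ⊤ : Submodule (IwasawaAlgebra 2) D.X)))
    (hup₂ : ∀ (κ : ZpExtension ℚ 2) (γ : Field.absoluteGaloisGroup ℚ), κ.IsCyclotomic →
      κ.IsTopGenerator γ → IsCyclotomicVariable 2 γ → ∀ D : W.SelmerDualData κ γ,
      Nat.card (D.X ⧸ (towerIdeal 2 2 • ⊤ : Submodule (IwasawaAlgebra 2) D.X)) ≤ 2 ^ n)
    (κ : ZpExtension ℚ 2) (γ : Field.absoluteGaloisGroup ℚ) (hκ : κ.IsCyclotomic)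
    (hγ : κ.IsTopGenerator γ) (hγ' : IsCyclotomicVariable 2 γ) (D : W.SelmerDualData κ γ) :
    D.IsTorsion ∧ D.mu = 0 ∧ n ≤ D.lambda := by
  have hgap := towerGapAtTwo_of_levelOne W hlow₁ hup₂
  obtain ⟨hX, hμ⟩ := isTorsion_and_mu_eq_zero_of_towerGapAtTwo W hgap hκ hγ hγ' D
  exact ⟨hX, hμ, le_lambda_of_towerGap_of_towerRank W h414 htors hgap
    (towerRank_of_levelOne W hlow₁) κ γ hκ hγ hγ' D⟩

/-- **Door (TOWER, level one): `MazurMainConjecture W 2`** on a good-ordinary-at-`2` curve with odd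
torsion order: PRINT {Kato 17.4 (1)(2)@2, Greenberg Prop. 4.14@2} + certificates {`hper₀`,
`2^n ≤ #X/(2,T)X`, `#X/(2,T²)X ≤ 2^n`, `μ_an = 0`, `λ_an = n`} — any analytic rank, any residual
image; the only layer above `ℚ` that is read is `ℚ(√2)`.
[cite: Kato2004Asterisque, Thm. 17.4 (1)(2) (p. 273)] [cite: GreenbergLNM1716, Prop. 4.14 (§4)]
[cite: GreenbergVatsal2000, p. 4 (after Thm. (1.2))] -/
theorem mazurMainConjecture_two_of_levelOne
    (h17 : ∀ [NeZero (W.conductorNorm ℤ)] (f : CuspForm (Gamma0 (W.conductorNorm ℤ)) 2),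
      kato_divisibility_allPrimes W 2 (f := f))
    (h414 : prop414_noFiniteSubmodule_of_not_dvd_torsionOrder)
    (hper₀ : ∀ [NeZero (W.conductorNorm ℤ)] (f : CuspForm (Gamma0 (W.conductorNorm ℤ)) 2),
      IsNewformOf W f → ∀ ϖ : ℚ, (ϖ : ℝ) * W.realPeriodRat = plusPeriod f → 0 ≤ padicValRat 2 ϖ)
    (hgo : GoodOrd W 2) (htors : ¬ 2 ∣ W.torsionOrder) {n : ℕ}
    (hlow₁ : ∀ (κ : ZpExtension ℚ 2) (γ : Field.absoluteGaloisGroup ℚ), κ.IsCyclotomic →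
      κ.IsTopGenerator γ → IsCyclotomicVariable 2 γ → ∀ D : W.SelmerDualData κ γ,
      2 ^ n ≤ Nat.card (D.X ⧸ (towerIdeal 2 1 • ⊤ : Submodule (IwasawaAlgebra 2) D.X)))
    (hup₂ : ∀ (κ : ZpExtension ℚ 2) (γ : Field.absoluteGaloisGroup ℚ), κ.IsCyclotomic →
      κ.IsTopGenerator γ → IsCyclotomicVariable 2 γ → ∀ D : W.SelmerDualData κ γ,
      Nat.card (D.X ⧸ (towerIdeal 2 2 • ⊤ : Submodule (IwasawaAlgebra 2) D.X)) ≤ 2 ^ n)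
    (hlan : AnalyticLambdaEq W 2 n) (hμan : AnalyticMuLE W 2 0) : MazurMainConjecture W 2 :=
  mazurMainConjecture_two_of_towerGap_of_towerRank W h17 h414 hper₀ hgo htors
    (towerGapAtTwo_of_levelOne W hlow₁ hup₂) (towerRank_of_levelOne W hlow₁) hlan hμan

/-- **The Kato–Néron half (the item `OrdKatoHalfAtTwo` AT `W`), level-one form.**
[cite: Kato2004Asterisque, Thm. 17.4 (1)(2) (p. 273)] [cite: GreenbergLNM1716, Prop. 4.14 (§4)] -/
theorem katoHalfAt_two_of_levelOne
    (h17 : ∀ [NeZero (W.conductorNorm ℤ)] (f : CuspForm (Gamma0 (W.conductorNorm ℤ)) 2),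
      kato_divisibility_allPrimes W 2 (f := f))
    (h414 : prop414_noFiniteSubmodule_of_not_dvd_torsionOrder)
    (hper₀ : ∀ [NeZero (W.conductorNorm ℤ)] (f : CuspForm (Gamma0 (W.conductorNorm ℤ)) 2),
      IsNewformOf W f → ∀ ϖ : ℚ, (ϖ : ℝ) * W.realPeriodRat = plusPeriod f → 0 ≤ padicValRat 2 ϖ)
    (hgo : GoodOrd W 2) (htors : ¬ 2 ∣ W.torsionOrder) {n : ℕ}
    (hlow₁ : ∀ (κ : ZpExtension ℚ 2) (γ : Field.absoluteGaloisGroup ℚ), κ.IsCyclotomic →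
      κ.IsTopGenerator γ → IsCyclotomicVariable 2 γ → ∀ D : W.SelmerDualData κ γ,
      2 ^ n ≤ Nat.card (D.X ⧸ (towerIdeal 2 1 • ⊤ : Submodule (IwasawaAlgebra 2) D.X)))
    (hup₂ : ∀ (κ : ZpExtension ℚ 2) (γ : Field.absoluteGaloisGroup ℚ), κ.IsCyclotomic →
      κ.IsTopGenerator γ → IsCyclotomicVariable 2 γ → ∀ D : W.SelmerDualData κ γ,
      Nat.card (D.X ⧸ (towerIdeal 2 2 • ⊤ : Submodule (IwasawaAlgebra 2) D.X)) ≤ 2 ^ n)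
    (hlan : AnalyticLambdaEq W 2 n) (hμan : AnalyticMuLE W 2 0) :
    MainConjectureLowerDivisibilityAtTwoOrd W :=
  katoHalfAt_two_of_towerGap_of_towerRank W h17 h414 hper₀ hgo htors
    (towerGapAtTwo_of_levelOne W hlow₁ hup₂) (towerRank_of_levelOne W hlow₁) hlan hμan

/-- **Door (TOWER, level one) for `BSD(E,2)` at analytic rank `0`** on a good-ordinary-at-`2` curve
with odd torsion order: PRINT {modularity, GZK, Kato 17.4 (1)(2)@2, Greenberg Thm. 4.1@2 (`hEC`,
δ = 0), Greenberg Prop. 4.14@2} + certificates {`hper₀`, `2^n ≤ #X/(2,T)X`, `#X/(2,T²)X ≤ 2^n`,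
`μ_an = 0`, `λ_an = n`} ⇒ `BSDp W 2`. [cite: GreenbergLNM1716, Thm. 4.1 (p. 102), Prop. 4.14 (§4)]
[cite: Kato2004Asterisque, Thm. 17.4 (1)(2) (p. 273)] [cite: Miller2011LMS, Def. 1.1] -/
theorem bsdp_two_of_levelOne (hmod : nonempty_modularParametrizationData)
    (hGZK : rank_eq_analyticRank_of_analyticRank_le_one)
    (h17 : ∀ [NeZero (W.conductorNorm ℤ)] (f : CuspForm (Gamma0 (W.conductorNorm ℤ)) 2),
      kato_divisibility_allPrimes W 2 (f := f))
    (hEC : TwoAdicEulerCharRankZero W 0) (h414 : prop414_noFiniteSubmodule_of_not_dvd_torsionOrder)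
    (hper₀ : ∀ [NeZero (W.conductorNorm ℤ)] (f : CuspForm (Gamma0 (W.conductorNorm ℤ)) 2),
      IsNewformOf W f → ∀ ϖ : ℚ, (ϖ : ℝ) * W.realPeriodRat = plusPeriod f → 0 ≤ padicValRat 2 ϖ)
    (hgo : GoodOrd W 2) (hr : W.analyticRank = 0) (htors : ¬ 2 ∣ W.torsionOrder) {n : ℕ}
    (hlow₁ : ∀ (κ : ZpExtension ℚ 2) (γ : Field.absoluteGaloisGroup ℚ), κ.IsCyclotomic →
      κ.IsTopGenerator γ → IsCyclotomicVariable 2 γ → ∀ D : W.SelmerDualData κ γ,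
      2 ^ n ≤ Nat.card (D.X ⧸ (towerIdeal 2 1 • ⊤ : Submodule (IwasawaAlgebra 2) D.X)))
    (hup₂ : ∀ (κ : ZpExtension ℚ 2) (γ : Field.absoluteGaloisGroup ℚ), κ.IsCyclotomic →
      κ.IsTopGenerator γ → IsCyclotomicVariable 2 γ → ∀ D : W.SelmerDualData κ γ,
      Nat.card (D.X ⧸ (towerIdeal 2 2 • ⊤ : Submodule (IwasawaAlgebra 2) D.X)) ≤ 2 ^ n)
    (hlan : AnalyticLambdaEq W 2 n) (hμan : AnalyticMuLE W 2 0) : BSDp W 2 :=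
  bsdp_two_of_towerGap_of_towerRank W hmod hGZK h17 hEC h414 hper₀ hgo hr htors
    (towerGapAtTwo_of_levelOne W hlow₁ hup₂) (towerRank_of_levelOne W hlow₁) hlan hμan

end Curve

end Summit.BirchSwinnertonDyer.BirchSwinnertonDyer.Theorems.KatoHalfPinch

end
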